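import Literature.AlgebraicTopology.Homotopy.SerreFibrationCube
import Literature.AlgebraicTopology.SingularHomology.CechCapBridge
import HarnessLib

/-!
# Serre fibrations over a cube: `H_{n+m}(P, P|∂Iᵐ) ≅ H_n(P)` compatibly with cap products

Topic `Literature/AlgebraicTopology/Homotopy`, sibling of `SerreFibrationCube.lean`. That file
proves the single-cell computation of the `E¹`-term of the spectral sequence of a fibration
(E. H. Spanier, *Algebraic Topology* (1981), Ch. 9, Sec. 2, Thm. 15 (a),
"`ψ_* : H_s(e, ė; Hₙ(F)) ≈ H_{n+s}(p⁻¹(e), p⁻¹(ė))`") for SERRE fibrations `q : P → Iᵈ`, in the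
naturality form `f_*` iso on `H_{k+d}(P, q⁻¹∂Iᵈ)` iff `f_*` iso on `H_k(P)`, by induction on `d`
along the isomorphisms `δ` (boundary of the triple `(P, q⁻¹∂, q⁻¹J)`), `ι` (inclusion of the
free-face pair) and the weak equivalence `q⁻¹(face) ↪ P`. Here the same chain is run once more,
keeping track of CAP PRODUCTS with a class `θ ∈ H²(P; R)` instead of a fibrewise map: every link
is a connecting map or is induced by a map of pairs, hence commutes with `θ ⌢ ·` (boundary formula
`∂(a ⌢ z) = (-1)² (a|) ⌢ ∂z`, `δ_relCapProduct`; `j_*`-compatibility `relCapProduct_ofAbsolute`;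
projection formula for pairs `map_relCapProduct` and for spaces `capProduct_map`; Hatcher 2002,
§3.3 pp. 239–241). Result:

* `SerreCube.exists_conj_cap` — for a Serre fibration `q : P → Iᵈ` and `θ ∈ H²(P; R)` there are
  `R`-linear bijections `φ_k : H_{k+d}(P, q⁻¹∂Iᵈ; R) → H_k(P; R)` with
  `φ_k (θ ⌢ x) = θ ⌢ φ_{k+2} x`.

This is the cube step of hard Lefschetz on the `E¹`-term of the Leray–Serre spectral sequence of a
projective family (C. Voisin, *Hodge Theory and Complex Algebraic Geometry II* (2003), proof of
Thm. 4.15: the relative Lefschetz operator acts on `E₂^{p,q} = Hᵖ(B, R^qφ_*ℚ)` through its action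
on the fibres), in the homological cap-product form of the tree. Everything is proved; no named
fact is introduced.

## References

* E. H. Spanier, *Algebraic Topology*, Springer (1981), Ch. 9, Sec. 2, Thm. 15 (a). [Spanier1981]
* A. Hatcher, *Algebraic Topology*, CUP (2002), §3.3 pp. 239–241. [HatcherAT2002]
* C. Voisin, *Hodge Theory and Complex Algebraic Geometry II*, CUP (2003), Lemma 4.13, Thm. 4.15.
  [VoisinHodgeII2003]
-/

noncomputable section

open Set Function Metric unitInterval CategoryTheory CategoryTheory.Limits
open scoped Topology unitInterval
open Literature.AlgebraicTopology.SingularHomology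

namespace Literature.AlgebraicTopology.Homotopy

universe u uR

namespace SerreCube

variable (R : Type uR) [CommRing R]

/-! ### Cap products along the links `δ`, `ι`, `q⁻¹(face) ↪ P` -/

section Links

variable {m : ℕ} {P : Type u} [TopologicalSpace P] {q : P → (Fin (m + 1) → I)}
  (θ : singularCohomology R R P 2)

/-- **The boundary of the triple `(P, q⁻¹∂, q⁻¹J)` commutes with `θ ⌢ ·`** (boundary formula with
the sign `(-1)² = 1`, then `j_*`). [cite: HatcherAT2002, §3.3 p. 240 and p. 254] -/
theorem tripleδ_relCapProduct_two (n n' : ℕ) (h : 2 + n = n')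
    (x : relativeSingularHomology R R P (bdP q) (n' + 1)) :
    relativeSingularHomology.tripleδ R R P (bdP q) (jbP q) n
        (relCapProduct (bdP q) (show 2 + (n + 1) = n' + 1 by omega) θ x) =
      relCapProduct (Subtype.val ⁻¹' jbP q) h (singularCohomology.map R R (⟨Subtype.val, continuous_subtype_val⟩ : C(↥(bdP q), P)) 2 θ)
        (relativeSingularHomology.tripleδ R R P (bdP q) (jbP q) n' x) := by
  simp only [relativeSingularHomology.tripleδ, ModuleCat.comp_apply]
  rw [δ_relCapProduct (bdP q) h θ x, show ((-1 : R) ^ 2) = 1 by norm_num, one_smul,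
    relCapProduct_ofAbsolute]

/-- `θ|_{q⁻¹∂}` restricts on the free face to `θ|_{q⁻¹(face)}`. [folklore] -/
theorem map_faceIncl_restrict_val :
    singularCohomology.map R R (faceIncl q) 2
        (singularCohomology.map R R (⟨Subtype.val, continuous_subtype_val⟩ : C(↥(bdP q), P)) 2 θ) =
      singularCohomology.map R R (faceVal q) 2 θ := by
  change (singularCohomology.map R R (⟨Subtype.val, continuous_subtype_val⟩ : C(↥(bdP q), P)) 2 ≫
    singularCohomology.map R R (faceIncl q) 2) θ = _
  rw [← singularCohomology.map_comp]
  rfl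

/-- **The inclusion `ι` of the free-face pair commutes with `θ ⌢ ·`** (projection formula for
maps of pairs). [cite: HatcherAT2002, §3.3 p. 241] -/
theorem map_faceIncl_relCapProduct_two (n n' : ℕ) (h : 2 + n = n')
    (y : relativeSingularHomology R R (FaceP q) (Subtype.val ⁻¹' (q ⁻¹' jb m)) n') :
    relativeSingularHomology.map R R (faceIncl q) (mapsTo_faceIncl (q := q)) n
        (relCapProduct (Subtype.val ⁻¹' (q ⁻¹' jb m)) h (singularCohomology.map R R (faceVal q) 2 θ) y) =
      relCapProduct (Subtype.val ⁻¹' jbP q) h (singularCohomology.map R R (⟨Subtype.val, continuous_subtype_val⟩ : C(↥(bdP q), P)) 2 θ)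
        (relativeSingularHomology.map R R (faceIncl q) (mapsTo_faceIncl (q := q)) n' y) := by
  rw [← map_faceIncl_restrict_val, relativeSingularHomology.map_relCapProduct]

/-- **`q⁻¹(face) ↪ P` commutes with `θ ⌢ ·`** (projection formula). [cite: HatcherAT2002, §3.3 p. 241] -/
theorem map_faceVal_capProduct_two (n n' : ℕ) (h : 2 + n = n')
    (c : singularHomology R R (FaceP q) n') :
    singularHomology.map R R (faceVal q) n (capProduct h (singularCohomology.map R R (faceVal q) 2 θ) c) =
      capProduct h θ (singularHomology.map R R (faceVal q) n' c) :=
  capProduct_map (faceVal q) h θ c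

end Links

/-! ### The induction -/

/-- A `ModuleCat` isomorphism is a bijection. [folklore] -/
theorem bijective_of_isIso' {M N : ModuleCat.{max u uR} R} (f : M ⟶ N) [IsIso f] :
    Function.Bijective f.hom :=
  (asIso f).toLinearEquiv.bijective

/-- **Cap-compatible identification `H_{k+d}(P, q⁻¹∂Iᵈ) ≅ H_k(P)` for a Serre fibration over the
cube `Iᵈ`** (the inductive statement, with the boundary preimage abstracted as `A`): there are
linear bijections `φ_k` with `φ_k (θ ⌢ x) = θ ⌢ φ_{k+2} x`. Induction on `d` along `δ`, `ι`, the
free-face fibration and `q⁻¹(face) ↪ P`, as in `SerreCube.main_aux`.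
[cite: Spanier1981, Ch. 9, Sec. 2, Thm. 15 (a); VoisinHodgeII2003, Thm. 4.15 (proof)] -/
theorem conj_cap_aux : ∀ (d : ℕ) {P : Type u} [TopologicalSpace P] {q : P → (Fin d → I)}
    (_ : IsSerreFibration q) {A : Set P} (_ : A = q ⁻¹' Cube.boundary (Fin d))
    (θ : singularCohomology R R P 2),
    ∃ φ : ∀ k, relativeSingularHomology R R P A (k + d) →ₗ[R] singularHomology R R P k,
      (∀ k, Function.Bijective (φ k)) ∧
      ∀ (k : ℕ) (x : relativeSingularHomology R R P A (k + 2 + d)),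
        φ k (relCapProduct A (show 2 + (k + d) = k + 2 + d by omega) θ x) =
          capProduct (show 2 + k = k + 2 by omega) θ (φ (k + 2) x) := by
  intro d
  induction d with
  | zero =>
    intro P _ q hq A hA θ
    subst hA
    haveI : IsEmpty ↥(q ⁻¹' Cube.boundary (Fin 0)) := ⟨fun z => by
      obtain ⟨i, -⟩ := (z.2 : q z.1 ∈ Cube.boundary (Fin 0)); exact i.elim0⟩
    haveI := fun k => relativeSingularHomology.isIso_ofAbsolute_of_isEmpty R R (X := P)
      (q ⁻¹' Cube.boundary (Fin 0)) k
    let e : ∀ k, singularHomology R R P k ≃ₗ[R]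
        relativeSingularHomology R R P (q ⁻¹' Cube.boundary (Fin 0)) k := fun k =>
      (asIso (relativeSingularHomology.ofAbsolute R R P (q ⁻¹' Cube.boundary (Fin 0)) k)).toLinearEquiv
    have he : ∀ k (c : singularHomology R R P k),
        e k c = relativeSingularHomology.ofAbsolute R R P (q ⁻¹' Cube.boundary (Fin 0)) k c :=
      fun k c => rfl
    refine ⟨fun k => (e k).symm.toLinearMap, fun k => (e k).symm.bijective, fun k x => ?_⟩
    apply (e k).injective
    change e k ((e k).symm _) = e k (capProduct _ θ ((e (k + 2)).symm x))
    rw [LinearEquiv.apply_symm_apply, he, ← relCapProduct_ofAbsolute, ← he,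
      LinearEquiv.apply_symm_apply]
  | succ m ih =>
    intro P _ q hq A hA θ
    subst hA
    -- the four links
    haveI := fun n => isIso_tripleδ R hq n
    haveI := fun n => isIso_ι R hq n
    obtain ⟨φF, hφF, hcommF⟩ := ih (isSerreFibration_faceMap hq) faceMap_preimage_boundary.symm
      (singularCohomology.map R R (faceVal q) 2 θ)
    haveI := fun k => isIso_singularHomology_map_of_isWeakHomotopyEquiv (R := R) (faceVal q)
      (isWeakHomotopyEquiv_faceVal hq) k
    let eδ : ∀ n, relativeSingularHomology R R P (bdP q) (n + 1) ≃ₗ[R]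
        relativeSingularHomology R R ↥(bdP q) (Subtype.val ⁻¹' jbP q) n := fun n =>
      (asIso (relativeSingularHomology.tripleδ R R P (bdP q) (jbP q) n)).toLinearEquiv
    have heδ : ∀ n x, eδ n x = relativeSingularHomology.tripleδ R R P (bdP q) (jbP q) n x :=
      fun n x => rfl
    let eι : ∀ n, relativeSingularHomology R R (FaceP q) (Subtype.val ⁻¹' (q ⁻¹' jb m)) n ≃ₗ[R]
        relativeSingularHomology R R ↥(bdP q) (Subtype.val ⁻¹' jbP q) n := fun n =>
      (asIso (relativeSingularHomology.map R R (faceIncl q) (mapsTo_faceIncl (q := q)) n)).toLinearEquiv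
    have heι : ∀ n y, eι n y = relativeSingularHomology.map R R (faceIncl q) (mapsTo_faceIncl (q := q)) n y :=
      fun n y => rfl
    let eV : ∀ k, singularHomology R R (FaceP q) k ≃ₗ[R] singularHomology R R P k := fun k =>
      (asIso (singularHomology.map R R (faceVal q) k)).toLinearEquiv
    have heV : ∀ k c, eV k c = singularHomology.map R R (faceVal q) k c := fun k c => rfl
    refine ⟨fun k => (eV k).toLinearMap ∘ₗ φF k ∘ₗ (eι (k + m)).symm.toLinearMap ∘ₗ
      (eδ (k + m)).toLinearMap, fun k => ?_, fun k x => ?_⟩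
    · exact (eV k).bijective.comp ((hφF k).comp ((eι (k + m)).symm.bijective.comp (eδ (k + m)).bijective))
    · -- the chain of commutations
      change eV k (φF k ((eι (k + m)).symm (eδ (k + m) (relCapProduct (bdP q) _ θ x)))) =
        capProduct _ θ (eV (k + 2) (φF (k + 2) ((eι (k + 2 + m)).symm (eδ (k + 2 + m) x))))
      -- (1) `δ`
      have h1 : eδ (k + m) (relCapProduct (bdP q) (show 2 + (k + (m + 1)) = k + 2 + (m + 1) by omega) θ x) =
          relCapProduct (Subtype.val ⁻¹' jbP q) (show 2 + (k + m) = k + 2 + m by omega) (singularCohomology.map R R (⟨Subtype.val, continuous_subtype_val⟩ : C(↥(bdP q), P)) 2 θ)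
            (eδ (k + 2 + m) x) := by
        rw [heδ, heδ]
        exact tripleδ_relCapProduct_two R θ (k + m) (k + 2 + m) (by omega) x
      -- (2) `ι⁻¹`
      have h2 : ∀ w, (eι (k + m)).symm (relCapProduct (Subtype.val ⁻¹' jbP q)
            (show 2 + (k + m) = k + 2 + m by omega) (singularCohomology.map R R (⟨Subtype.val, continuous_subtype_val⟩ : C(↥(bdP q), P)) 2 θ) w) =
          relCapProduct (Subtype.val ⁻¹' (q ⁻¹' jb m)) (show 2 + (k + m) = k + 2 + m by omega)
            (singularCohomology.map R R (faceVal q) 2 θ) ((eι (k + 2 + m)).symm w) := fun w => by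
        apply (eι (k + m)).injective
        rw [LinearEquiv.apply_symm_apply, heι, map_faceIncl_relCapProduct_two, ← heι,
          LinearEquiv.apply_symm_apply]
      -- (3) the face, (4) `faceVal`
      rw [h1, h2, hcommF k, heV, map_faceVal_capProduct_two R θ k (k + 2) (by omega), ← heV]

variable {d : ℕ} {P : Type u} [TopologicalSpace P] {q : P → (Fin d → I)}

/-- **Spanier's Thm. 9.2.15 (a) over a cube, cap-product form.** For a Serre fibration
`q : P → Iᵈ` and a class `θ ∈ H²(P; R)` there are `R`-linear bijections
`φ_k : H_{k+d}(P, q⁻¹∂Iᵈ; R) → H_k(P; R)` intertwining the cap products with `θ`: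
`φ_k (θ ⌢ x) = θ ⌢ φ_{k+2} x`. [cite: Spanier1981, Ch. 9, Sec. 2, Thm. 15 (a); VoisinHodgeII2003, Thm. 4.15 (proof)] -/
theorem exists_conj_cap (hq : IsSerreFibration q) (θ : singularCohomology R R P 2) :
    ∃ φ : ∀ k, relativeSingularHomology R R P (q ⁻¹' Cube.boundary (Fin d)) (k + d) →ₗ[R]
        singularHomology R R P k,
      (∀ k, Function.Bijective (φ k)) ∧
      ∀ (k : ℕ) (x : relativeSingularHomology R R P (q ⁻¹' Cube.boundary (Fin d)) (k + 2 + d)),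
        φ k (relCapProduct (q ⁻¹' Cube.boundary (Fin d)) (show 2 + (k + d) = k + 2 + d by omega) θ x) =
          capProduct (show 2 + k = k + 2 by omega) θ (φ (k + 2) x) :=
  conj_cap_aux R d hq rfl θ

end SerreCube

end Literature.AlgebraicTopology.Homotopy
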